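import Literature.NumberTheory.Transcendental.ExpPointsBranchLaurent
import Literature.NumberTheory.Transcendental.ExpPointsExamples
import Literature.NumberTheory.Transcendental.ExpCurveZeros
import Literature.Analysis.Complex.MeromorphicCurveGerms
import Mathlib.Analysis.Complex.Exponential
import Mathlib.Analysis.Normed.Module.Convex
import HarnessLib

/-!
# Log-type ends of a curve of exponential points, regular case: a degenerate section

Setting: `W ⊆ ℂ² × ℂ²`, `zariskiDim ℂ W < 2`, and a branch at infinity
`𝔟(t) = ((t⁻ᵉ, Φ₁ t / tᴺ), (Φ₂ t / tᴺ, Φ₃ t / tᴺ)) ∈ W` (`0 < |t|` small) through infinitely many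
independent exponential points with parameters accumulating at `t = 0`
(`ExpPointsBranchAtInfinity`), whose multiplicative coordinates have the form
`yⱼ = t^{μⱼ} e^{ℓⱼ(t)}` (`BranchOrders`). The end is LOG-TYPE if `(μ₀, μ₁) ≠ 0`. At every hit
`e^{x} = y`, so the meromorphic germ `Φ = μ₁ (x₀ - ℓ₀) - μ₀ (x₁ - ℓ₁)` takes values in `2πiℤ` at
the hits. If `Φ` is REGULAR at `0` (this file), it is constant near `0`, hence so is
`L = μ₁ x₀ - μ₀ x₁` along the branch: the function `L` is analytic at `0` modulo its value there,
`e^{L} = y₀^{μ₁} y₁^{-μ₀}` is algebraic over `ℂ(x₀)` as are all branch coordinates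
(`ExpPointsBranchLaurent`, through Laurent expansions in `ℂ⸨X⸩`), and a non-constant analytic
`L` with `e^{L}` algebraic over `ℂ(L)` is impossible (`ExpCurveZeros`). Consequently infinitely
many independent exponential points lie on the DEGENERATE SECTION `μ₁ x₀ - μ₀ x₁ = c`
(`exists_degenerate_section_of_logType_regular`). PROVED, no definition. [folklore]
-/

noncomputable section

open Complex Filter Topology Set Metric PowerSeries HahnSeries LaurentSeries MvPolynomial

namespace Literature.NumberTheory.Transcendental

open Literature.Analysis.Complex.LaurentGerm
open Literature.Analysis.Complex.MeromorphicGerm (analyticAt_pow_succ_mul_div_pow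
  analyticAt_pow_succ_mul_inv_pow exists_radius_eq_zero frequently_nhdsNE_of_forall_exists)
open Literature.FieldTheory.TranscendenceDegree (exists_relation_of_isAlgebraic_pair
  isAlgebraic_adjoin_of_mem)
open Literature.Analysis.Complex.FormalRoot (eventuallyEq_of_taylor_eq taylor_polynomial)
open Literature.NumberTheory.Transcendental.AndreCriterion (coeff_taylor)
open Literature.RingTheory.PowerSeries (algebraMap_laurentSeries_apply)

/-- The Taylor series of `f : ℂ → ℂ` at `0`, as a formal power series (local notation). -/
local notation3 "𝓣[" f "]" =>
  (PowerSeries.mk fun n => ((Nat.factorial n : ℂ)⁻¹ * iteratedDeriv n f 0) : PowerSeries ℂ)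

/-- The Laurent expansion at `0` of a germ `f` with `zⁿ f(z)` analytic at `0` (local notation). -/
local notation3 "𝓛[" n ", " f "]" =>
  (HahnSeries.single (-((n : ℕ) : ℤ)) (1 : ℂ) *
    HahnSeries.ofPowerSeries ℤ ℂ 𝓣[fun z : ℂ => z ^ (n : ℕ) * (f : ℂ → ℂ) z] : LaurentSeries ℂ)

/-- The branch point `((t⁻ᵉ, Φ₁ t / tᴺ), (Φ₂ t / tᴺ, Φ₃ t / tᴺ)) ∈ ℂ² × ℂ²` (local notation). -/
local notation3 "𝔟[" e ", " N ", " Φ₁ ", " Φ₂ ", " Φ₃ ", " t "]" =>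
  (Sum.elim ![((t : ℂ) ^ (e : ℕ))⁻¹, (Φ₁ : ℂ → ℂ) t / t ^ (N : ℕ)]
    ![(Φ₂ : ℂ → ℂ) t / t ^ (N : ℕ), (Φ₃ : ℂ → ℂ) t / t ^ (N : ℕ)] : Fin 2 ⊕ Fin 2 → ℂ)

/-! ### Small tools -/

/-- From an eventual property on punctured neighbourhoods to a radius. [folklore] -/
theorem exists_radius_of_eventually {P : ℂ → Prop} (h : ∀ᶠ t in 𝓝[≠] (0 : ℂ), P t) :
    ∃ δ > 0, ∀ t : ℂ, 0 < ‖t‖ → ‖t‖ < δ → P t := by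
  obtain ⟨δ, hδ, hP⟩ := (Metric.nhdsWithin_basis_ball (s := ({0}ᶜ : Set ℂ)) (x := 0)).eventually_iff.1 h
  refine ⟨δ, hδ, fun t ht htδ => hP ⟨by rwa [mem_ball_zero_iff], ?_⟩⟩
  rw [Set.mem_compl_iff, Set.mem_singleton_iff]
  intro h0; rw [h0, norm_zero] at ht; exact lt_irrefl 0 ht

/-- From an eventual property on full neighbourhoods to a radius. [folklore] -/
theorem exists_radius_of_eventually_nhds {P : ℂ → Prop} (h : ∀ᶠ t in 𝓝 (0 : ℂ), P t) :
    ∃ δ > 0, ∀ t : ℂ, ‖t‖ < δ → P t := by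
  obtain ⟨δ, hδ, hP⟩ := Metric.eventually_nhds_iff_ball.1 h
  exact ⟨δ, hδ, fun t ht => hP t (by rwa [mem_ball_zero_iff])⟩

/-- An analytic germ which is not constant near `0` has a transcendental Taylor series.
[folklore] -/
theorem transcendental_taylor_of_not_eventually_const {Λ : ℂ → ℂ} (hΛ : AnalyticAt ℂ Λ 0)
    (hnc : ¬ ∀ᶠ t in 𝓝 (0 : ℂ), Λ t = Λ 0) :
    Transcendental ℂ (HahnSeries.ofPowerSeries ℤ ℂ 𝓣[Λ] : LaurentSeries ℂ) := by
  -- some Taylor coefficient of positive degree is non-zero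
  by_contra halg
  rw [Transcendental, not_not] at halg
  apply hnc
  have hcoeff : ∀ n : ℕ, n ≠ 0 → PowerSeries.coeff n 𝓣[Λ] = 0 := by
    intro n hn
    by_contra hc
    refine transcendental_of_coeff_ne_zero (n := (n : ℤ)) (by exact_mod_cast hn) ?_ halg
    rwa [LaurentSeries.coeff_coe_powerSeries]
  have hT : 𝓣[Λ] = 𝓣[fun _ : ℂ => Λ 0] := by
    have h2 := taylor_polynomial (Polynomial.C (Λ 0))
    simp only [Polynomial.eval_C] at h2
    rw [h2, Polynomial.coe_C]
    ext n
    by_cases hn : n = 0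
    · subst hn
      rw [PowerSeries.coeff_zero_C, coeff_taylor]
      simp
    · rw [hcoeff n hn, PowerSeries.coeff_C, if_neg hn]
  exact eventuallyEq_of_taylor_eq hΛ analyticAt_const hT

/-- **`e^{Λ}` algebraic over `ℂ(Λ)` with `Λ` analytic forces `Λ` constant near `0`** (germ
form of `ExpCurveZeros`): if a non-trivial polynomial relation `R(Λ, e^{Λ}) = 0` holds on a
punctured neighbourhood of `0`, then `Λ` is constant near `0`. [folklore] -/
theorem eventually_const_of_relation_exp {Λ : ℂ → ℂ} (hΛ : AnalyticAt ℂ Λ 0)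
    {R : MvPolynomial (Fin 2) ℂ} (hR : R ≠ 0)
    (h : ∀ᶠ t in 𝓝[≠] (0 : ℂ), MvPolynomial.eval ![Λ t, exp (Λ t)] R = 0) :
    ∀ᶠ t in 𝓝 (0 : ℂ), Λ t = Λ 0 := by
  have han : AnalyticAt ℂ (fun t => MvPolynomial.eval ![Λ t, exp (Λ t)] R) 0 := by
    have hexp : AnalyticAt ℂ (fun t => exp (Λ t)) 0 := analyticAt_cexp.comp hΛ
    have h1 : AnalyticAt ℂ (fun t : ℂ => t ^ 0 * Λ t) 0 := by simpa using hΛ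
    have h2 : AnalyticAt ℂ (fun t : ℂ => t ^ 0 * exp (Λ t)) 0 := by simpa using hexp
    have := (laurent_eval h1 h2 R (N := 0) (by simp)).2
    simpa using this
  have h0 : ∀ᶠ t in 𝓝 (0 : ℂ), MvPolynomial.eval ![Λ t, exp (Λ t)] R = 0 :=
    eventuallyEq_zero_of_puncture han h
  obtain ⟨δ₁, hδ₁, h1⟩ := exists_radius_of_eventually_nhds h0
  obtain ⟨δ₂, hδ₂, h2⟩ := exists_radius_of_eventually_nhds hΛ.eventually_analyticAt
  set δ := min δ₁ δ₂ with hδ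
  have hcont : ContinuousOn Λ (ball (0 : ℂ) δ) := fun t ht =>
    (h2 t ((mem_ball_zero_iff.1 ht).trans_le (min_le_right _ _))).continuousAt.continuousWithinAt
  have hconst := eval_exp_const_of_isPreconnected (convex_ball (0 : ℂ) δ).isPreconnected hcont hR
    (fun t ht => h1 t ((mem_ball_zero_iff.1 ht).trans_le (min_le_left _ _)))
  have hmem : ball (0 : ℂ) δ ∈ 𝓝 (0 : ℂ) := ball_mem_nhds 0 (lt_min hδ₁ hδ₂)
  filter_upwards [hmem] with t ht
  exact hconst t ht 0 (mem_ball_self (lt_min hδ₁ hδ₂))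

/-! ### The regular log-type case -/

/-- **Regular log-type ends carry a degenerate section.** In the setting of the module
docstring, assume the end is log-type (`(μ₀, μ₁) ≠ 0`) and the germ
`Φ = μ₁ (t⁻ᵉ - ℓ₀) - μ₀ (x₁ - ℓ₁)` is regular at `0` (coincides with an analytic germ on a
punctured neighbourhood). Then some degenerate section `{a x₀ + b x₁ = c}`, `(a, b) ∈ ℤ² ∖ 0`,
carries infinitely many independent exponential points of `W`. [folklore] -/
theorem exists_degenerate_section_of_logType_regular {W : Set (Fin 2 ⊕ Fin 2 → ℂ)}
    (hdim : zariskiDim ℂ W < 2) {e : ℕ} (he : 0 < e) {N : ℕ} {Φ₁ Φ₂ Φ₃ : ℂ → ℂ}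
    (hΦ₁ : AnalyticAt ℂ Φ₁ 0) (hΦ₂ : AnalyticAt ℂ Φ₂ 0) (hΦ₃ : AnalyticAt ℂ Φ₃ 0)
    (hW : ∀ᶠ t in 𝓝[≠] (0 : ℂ), 𝔟[e, N, Φ₁, Φ₂, Φ₃, t] ∈ W)
    (hhit : ∀ δ : ℝ, 0 < δ → Set.Infinite {x | x ∈ indepExpPoints W ∧ ∃ t : ℂ, 0 < ‖t‖ ∧
      ‖t‖ < δ ∧ Sum.elim x (Complex.exp ∘ x) = 𝔟[e, N, Φ₁, Φ₂, Φ₃, t]})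
    {μ₀ μ₁ : ℤ} {ℓ₀ ℓ₁ : ℂ → ℂ} (hℓ₀ : AnalyticAt ℂ ℓ₀ 0) (hℓ₁ : AnalyticAt ℂ ℓ₁ 0)
    (hy₀ : ∀ᶠ t in 𝓝[≠] (0 : ℂ), Φ₂ t / t ^ N = t ^ μ₀ * exp (ℓ₀ t))
    (hy₁ : ∀ᶠ t in 𝓝[≠] (0 : ℂ), Φ₃ t / t ^ N = t ^ μ₁ * exp (ℓ₁ t))
    (hμ : μ₀ ≠ 0 ∨ μ₁ ≠ 0) {Φh : ℂ → ℂ} (hΦh : AnalyticAt ℂ Φh 0)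
    (hreg : ∀ᶠ t in 𝓝[≠] (0 : ℂ),
      (μ₁ : ℂ) * ((t ^ e)⁻¹ - ℓ₀ t) - (μ₀ : ℂ) * (Φ₁ t / t ^ N - ℓ₁ t) = Φh t) :
    ∃ a b : ℤ, (a ≠ 0 ∨ b ≠ 0) ∧ ∃ c : ℂ,
      Set.Infinite {x : Fin 2 → ℂ | x ∈ indepExpPoints W ∧ (a : ℂ) * x 0 + (b : ℂ) * x 1 = c} := by
  classical
  -- ### Step 0: radii where everything holds
  set Λ : ℂ → ℂ := fun t => Φh t + (μ₁ : ℂ) * ℓ₀ t - (μ₀ : ℂ) * ℓ₁ t with hΛdef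
  have hΛan : AnalyticAt ℂ Λ 0 :=
    (hΦh.add (analyticAt_const.mul hℓ₀)).sub (analyticAt_const.mul hℓ₁)
  have hLΛ : ∀ᶠ t in 𝓝[≠] (0 : ℂ),
      (μ₁ : ℂ) * (t ^ e)⁻¹ - (μ₀ : ℂ) * (Φ₁ t / t ^ N) = Λ t := by
    filter_upwards [hreg] with t ht
    simp only [hΛdef, ← ht]; ring
  obtain ⟨δA, hδA, hA⟩ := exists_radius_of_eventually ((hy₀.and hy₁).and (hreg.and hLΛ))
  -- continuity of `Φh` at `0`: `‖Φh t - Φh 0‖ < π` near `0`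
  have hπ : ∀ᶠ t in 𝓝 (0 : ℂ), ‖Φh t - Φh 0‖ < Real.pi := by
    have := hΦh.continuousAt
    rw [ContinuousAt, Metric.tendsto_nhds] at this
    filter_upwards [this Real.pi Real.pi_pos] with t ht
    rwa [dist_eq_norm] at ht
  obtain ⟨δB, hδB, hB⟩ := exists_radius_of_eventually_nhds hπ
  set δ₀ : ℝ := min δA δB with hδ₀
  have hδ₀pos : 0 < δ₀ := lt_min hδA hδB
  -- ### Step 1: at a hit, `Φh t ∈ 2πiℤ`
  have hint : ∀ (x : Fin 2 → ℂ) (t : ℂ), 0 < ‖t‖ → ‖t‖ < δ₀ →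
      Sum.elim x (Complex.exp ∘ x) = 𝔟[e, N, Φ₁, Φ₂, Φ₃, t] → ∃ k : ℤ, Φh t = k * (2 * Real.pi * I) := by
    intro x t ht0 htδ hpt
    obtain ⟨⟨h0, h1⟩, h2, -⟩ := hA t ht0 (htδ.trans_le (min_le_left _ _))
    have hx0 : x 0 = (t ^ e)⁻¹ := by
      have := congrFun hpt (Sum.inl 0); simpa using this
    have hx1 : x 1 = Φ₁ t / t ^ N := by
      have := congrFun hpt (Sum.inl 1); simpa using this
    have hex0 : exp (x 0) = Φ₂ t / t ^ N := by
      have := congrFun hpt (Sum.inr 0); simpa using this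
    have hex1 : exp (x 1) = Φ₃ t / t ^ N := by
      have := congrFun hpt (Sum.inr 1); simpa using this
    have htne : t ≠ 0 := norm_pos_iff.1 ht0
    have hE0 : exp (x 0 - ℓ₀ t) = t ^ μ₀ := by
      rw [Complex.exp_sub, hex0, h0, mul_div_assoc, div_self (Complex.exp_ne_zero _), mul_one]
    have hE1 : exp (x 1 - ℓ₁ t) = t ^ μ₁ := by
      rw [Complex.exp_sub, hex1, h1, mul_div_assoc, div_self (Complex.exp_ne_zero _), mul_one]
    have hone : exp (Φh t) = 1 := by
      rw [← h2, ← hx0, ← hx1, Complex.exp_sub, Complex.exp_int_mul, Complex.exp_int_mul, hE0, hE1,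
        ← zpow_mul, ← zpow_mul, mul_comm μ₀ μ₁, div_self (zpow_ne_zero _ htne)]
    obtain ⟨k, hk⟩ := Complex.exp_eq_one_iff.1 hone
    exact ⟨k, hk⟩
  -- ### Step 2: a reference hit and constancy of `Φh` on the hits
  obtain ⟨x₁, hx₁H, t₁, ht₁0, ht₁δ, hpt₁⟩ := (hhit δ₀ hδ₀pos).nonempty
  obtain ⟨k₁, hk₁⟩ := hint x₁ t₁ ht₁0 ht₁δ hpt₁
  have hc₀exp : exp (Φh t₁) = 1 := by rw [hk₁, Complex.exp_int_mul_two_pi_mul_I]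
  have hconst : ∀ (x : Fin 2 → ℂ) (t : ℂ), 0 < ‖t‖ → ‖t‖ < δ₀ →
      Sum.elim x (Complex.exp ∘ x) = 𝔟[e, N, Φ₁, Φ₂, Φ₃, t] → Φh t = Φh t₁ := by
    intro x t ht0 htδ hpt
    obtain ⟨k, hk⟩ := hint x t ht0 htδ hpt
    have hd : ‖Φh t - Φh t₁‖ < 2 * Real.pi := by
      have ha := hB t (htδ.trans_le (min_le_right _ _))
      have hb := hB t₁ (ht₁δ.trans_le (min_le_right _ _))
      calc ‖Φh t - Φh t₁‖ = ‖(Φh t - Φh 0) - (Φh t₁ - Φh 0)‖ := by ring_nf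
        _ ≤ ‖Φh t - Φh 0‖ + ‖Φh t₁ - Φh 0‖ := norm_sub_le _ _
        _ < Real.pi + Real.pi := add_lt_add ha hb
        _ = 2 * Real.pi := by ring
    rw [hk, hk₁, ← sub_mul, ← Int.cast_sub] at hd
    have hkk : k = k₁ := by
      by_contra hne
      have h1 : (1 : ℝ) ≤ |((k - k₁ : ℤ) : ℝ)| := by
        rw [← Int.cast_abs]; exact_mod_cast Int.one_le_abs (sub_ne_zero.2 hne)
      have : 2 * Real.pi ≤ ‖((k - k₁ : ℤ) : ℂ) * (2 * Real.pi * I)‖ := by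
        rw [norm_mul, Complex.norm_intCast]
        have h2 : ‖(2 * Real.pi * I : ℂ)‖ = 2 * Real.pi := by
          simp [abs_of_pos Real.pi_pos]
        rw [h2]
        nlinarith [Real.pi_pos]
      linarith
    rw [hk, hkk, hk₁]
  -- ### Step 3: `Φh = c₀` near `0`, hence `Λ` is `L` on a punctured neighbourhood
  have hΦhc : ∀ᶠ t in 𝓝 (0 : ℂ), Φh t = Φh t₁ := by
    have hfr : ∃ᶠ t in 𝓝[≠] (0 : ℂ), Φh t - Φh t₁ = 0 := by
      refine frequently_nhdsNE_of_forall_exists fun ε hε => ?_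
      obtain ⟨x, hxH, t, ht0, htε, hpt⟩ := (hhit (min ε δ₀) (lt_min hε hδ₀pos)).nonempty
      exact ⟨t, ht0, htε.trans_le (min_le_left _ _),
        sub_eq_zero.2 (hconst x t ht0 (htε.trans_le (min_le_right _ _)) hpt)⟩
    have h := ((hΦh.sub analyticAt_const).frequently_zero_iff_eventually_zero).1 hfr
    filter_upwards [h] with t ht
    exact sub_eq_zero.1 ht
  -- ### Step 4: `Λ` is constant near `0`
  have hΛc : ∀ᶠ t in 𝓝 (0 : ℂ), Λ t = Λ 0 := by
    by_contra hnc
    -- tools for exponents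
    have raise : ∀ {f : ℂ → ℂ} {n K : ℕ}, AnalyticAt ℂ (fun t : ℂ => t ^ n * f t) 0 → n ≤ K →
        AnalyticAt ℂ (fun t : ℂ => t ^ K * f t) 0 := by
      intro f n K hf hle
      obtain ⟨k, rfl⟩ := Nat.exists_eq_add_of_le hle
      exact analyticAt_pow_add hf k
    have req : ∀ {f : ℂ → ℂ} {n K : ℕ} (hf : AnalyticAt ℂ (fun t : ℂ => t ^ n * f t) 0) (hle : n ≤ K),
        𝓛[K, f] = 𝓛[n, f] := fun hf hle => laurent_eq_of_analyticAt (raise hf hle) hf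
    -- Laurent expansions of the branch coordinates
    have hf₀ : AnalyticAt ℂ (fun t : ℂ => t ^ (e + 1) * (t ^ e)⁻¹) 0 := analyticAt_pow_succ_mul_inv_pow e
    have hf₁ : AnalyticAt ℂ (fun t : ℂ => t ^ (N + 1) * (Φ₁ t / t ^ N)) 0 :=
      analyticAt_pow_succ_mul_div_pow hΦ₁ N
    have hg₀ : AnalyticAt ℂ (fun t : ℂ => t ^ (N + 1) * (Φ₂ t / t ^ N)) 0 :=
      analyticAt_pow_succ_mul_div_pow hΦ₂ N
    have hg₁ : AnalyticAt ℂ (fun t : ℂ => t ^ (N + 1) * (Φ₃ t / t ^ N)) 0 :=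
      analyticAt_pow_succ_mul_div_pow hΦ₃ N
    have hx₀ : 𝓛[e + 1, fun t : ℂ => (t ^ e)⁻¹] = HahnSeries.single (-(e : ℤ)) (1 : ℂ) :=
      (laurent_inv_pow e).1
    have htr₀ : Transcendental ℂ 𝓛[e + 1, fun t : ℂ => (t ^ e)⁻¹] := by
      rw [hx₀]
      refine transcendental_of_coeff_ne_zero (n := -(e : ℤ)) (by omega) ?_
      rw [HahnSeries.coeff_single_same]; exact one_ne_zero
    obtain ⟨ha₁, ha₂, ha₃⟩ := isAlgebraic_coords_of_branch hdim hf₀ hf₁ hg₀ hg₁ hW htr₀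
    set R' := Algebra.adjoin ℂ ({𝓛[e + 1, fun t : ℂ => (t ^ e)⁻¹]} : Set (LaurentSeries ℂ)) with hR'
    have halg₀ : IsAlgebraic R' 𝓛[e + 1, fun t : ℂ => (t ^ e)⁻¹] := isAlgebraic_adjoin_of_mem rfl
    have hC : ∀ c : ℂ, IsAlgebraic R' (HahnSeries.C c : LaurentSeries ℂ) := fun c => by
      rw [← algebraMap_laurentSeries_apply]
      exact isAlgebraic_algebraMap
        (⟨algebraMap ℂ (LaurentSeries ℂ) c, Subalgebra.algebraMap_mem _ c⟩ : R')
    -- `Λ̂ ∈ cl{x̂₀}`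
    set K : ℕ := (e + 1) + (N + 1) with hK
    have hKf₀ : AnalyticAt ℂ (fun t : ℂ => t ^ K * ((μ₁ : ℂ) * (t ^ e)⁻¹)) 0 :=
      raise (analyticAt_const_mul hf₀ _) (Nat.le_add_right _ _)
    have hKf₁ : AnalyticAt ℂ (fun t : ℂ => t ^ K * ((μ₀ : ℂ) * (Φ₁ t / t ^ N))) 0 :=
      raise (analyticAt_const_mul hf₁ _) (Nat.le_add_left _ _)
    have hΛK : AnalyticAt ℂ (fun t : ℂ => t ^ K * Λ t) 0 :=
      raise (f := Λ) (n := 0) (by simpa using hΛan) (Nat.zero_le _)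
    have hLK : AnalyticAt ℂ
        (fun t : ℂ => t ^ K * ((μ₁ : ℂ) * (t ^ e)⁻¹ - (μ₀ : ℂ) * (Φ₁ t / t ^ N))) 0 := by
      have hneg : AnalyticAt ℂ (fun t : ℂ => t ^ K * (-((μ₀ : ℂ) * (Φ₁ t / t ^ N)))) 0 := by
        simpa using analyticAt_const_mul hKf₁ (-1)
      simpa [sub_eq_add_neg] using analyticAt_add hKf₀ hneg
    have hΛhat : (HahnSeries.ofPowerSeries ℤ ℂ 𝓣[Λ] : LaurentSeries ℂ) =
        HahnSeries.C (μ₁ : ℂ) * 𝓛[e + 1, fun t : ℂ => (t ^ e)⁻¹] -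
          HahnSeries.C (μ₀ : ℂ) * 𝓛[N + 1, fun t : ℂ => Φ₁ t / t ^ N] := by
      have h1 : (HahnSeries.ofPowerSeries ℤ ℂ 𝓣[Λ] : LaurentSeries ℂ) = 𝓛[K, Λ] := by
        rw [req (f := Λ) (n := 0) (by simpa using hΛan) (Nat.zero_le _), laurent_of_analyticAt]
      have h2 := laurent_sub hKf₀ hKf₁
      have h3 := laurent_congr hLK hΛK hLΛ
      beta_reduce at h2 h3
      rw [h1, ← h3, h2, laurent_const_mul, laurent_const_mul, req hf₀ (Nat.le_add_right _ _),
        req hf₁ (Nat.le_add_left _ _)]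
    have hΛalg : IsAlgebraic R' (HahnSeries.ofPowerSeries ℤ ℂ 𝓣[Λ] : LaurentSeries ℂ) := by
      rw [hΛhat]; exact ((hC _).mul halg₀).sub ((hC _).mul ha₁)
    have hΛtr : Transcendental ℂ (HahnSeries.ofPowerSeries ℤ ℂ 𝓣[Λ] : LaurentSeries ℂ) :=
      transcendental_taylor_of_not_eventually_const hΛan hnc
    -- ### `Ê ∈ cl{x̂₀}` via `e^Λ · y₀^{m₁} · y₁^{p₀} = y₀^{p₁} · y₁^{m₀}`
    set p₁ : ℕ := μ₁.toNat with hp₁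
    set m₁ : ℕ := (-μ₁).toNat with hm₁
    set p₀ : ℕ := μ₀.toNat with hp₀
    set m₀ : ℕ := (-μ₀).toNat with hm₀
    have hμ₁pm : (p₁ : ℤ) = μ₁ + m₁ := by rw [hp₁, hm₁]; omega
    have hμ₀pm : (m₀ : ℤ) = p₀ - μ₀ := by rw [hp₀, hm₀]; omega
    -- the pointwise identity on a punctured neighbourhood
    have hident : ∀ᶠ t in 𝓝[≠] (0 : ℂ),
        exp (Λ t) * (Φ₂ t / t ^ N) ^ m₁ * (Φ₃ t / t ^ N) ^ p₀ =
          (Φ₂ t / t ^ N) ^ p₁ * (Φ₃ t / t ^ N) ^ m₀ := by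
      have hc' : ∀ᶠ t in 𝓝[≠] (0 : ℂ), Φh t = Φh t₁ := eventually_nhdsWithin_of_eventually_nhds hΦhc
      filter_upwards [hy₀, hy₁, hc', self_mem_nhdsWithin] with t h0 h1 hc ht0'
      have ht0 : t ≠ 0 := by rintro rfl; exact ht0' (Set.mem_singleton 0)
      set y₀ := Φ₂ t / t ^ N with hy₀def
      set y₁ := Φ₃ t / t ^ N with hy₁def
      have hy₀ne : y₀ ≠ 0 := by rw [h0]; exact mul_ne_zero (zpow_ne_zero _ ht0) (Complex.exp_ne_zero _)
      have hy₁ne : y₁ ≠ 0 := by rw [h1]; exact mul_ne_zero (zpow_ne_zero _ ht0) (Complex.exp_ne_zero _)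
      have he0 : exp (ℓ₀ t) = y₀ * t ^ (-μ₀) := by
        rw [h0, zpow_neg, mul_assoc, mul_comm (exp _), ← mul_assoc, mul_inv_cancel₀ (zpow_ne_zero _ ht0),
          one_mul]
      have he1 : exp (ℓ₁ t) = y₁ * t ^ (-μ₁) := by
        rw [h1, zpow_neg, mul_assoc, mul_comm (exp _), ← mul_assoc, mul_inv_cancel₀ (zpow_ne_zero _ ht0),
          one_mul]
      have hEq : exp (Λ t) = y₀ ^ μ₁ * (y₁ ^ μ₀)⁻¹ := by
        have hΛt : Λ t = Φh t + (μ₁ : ℂ) * ℓ₀ t - (μ₀ : ℂ) * ℓ₁ t := rfl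
        have hmm : -μ₁ * μ₀ = -μ₀ * μ₁ := by ring
        rw [hΛt, Complex.exp_sub, Complex.exp_add, hc, hc₀exp, one_mul, Complex.exp_int_mul,
          Complex.exp_int_mul, he0, he1, mul_zpow, mul_zpow, ← zpow_mul, ← zpow_mul, hmm,
          mul_div_mul_right _ _ (zpow_ne_zero _ ht0), div_eq_mul_inv]
      rw [hEq, ← zpow_natCast y₀ m₁, ← zpow_natCast y₁ p₀, ← zpow_natCast y₀ p₁, ← zpow_natCast y₁ m₀,
        hμ₁pm, hμ₀pm, zpow_add₀ hy₀ne, zpow_sub₀ hy₁ne, div_eq_mul_inv]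
      ring
    -- Laurent expansion of both sides
    have hEan : AnalyticAt ℂ (fun t : ℂ => t ^ 0 * exp (Λ t)) 0 := by
      have hexp : AnalyticAt ℂ (fun t => exp (Λ t)) 0 := analyticAt_cexp.comp hΛan
      simpa using hexp
    obtain ⟨hpow₀m, han₀m⟩ := laurent_pow hg₀ m₁
    obtain ⟨hpow₁p, han₁p⟩ := laurent_pow hg₁ p₀
    obtain ⟨hpow₀p, han₀p⟩ := laurent_pow hg₀ p₁
    obtain ⟨hpow₁m, han₁m⟩ := laurent_pow hg₁ m₀
    beta_reduce at hpow₀m han₀m hpow₁p han₁p hpow₀p han₀p hpow₁m han₁m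
    have hanL1 := analyticAt_mul hEan han₀m
    have hL1 := laurent_mul hEan han₀m
    beta_reduce at hanL1 hL1
    have hanL := analyticAt_mul hanL1 han₁p
    have hL := laurent_mul hanL1 han₁p
    have hanR := analyticAt_mul han₀p han₁m
    have hR := laurent_mul han₀p han₁m
    beta_reduce at hanL hL hanR hR
    set A : ℕ := 0 + (N + 1) * m₁ + (N + 1) * p₀ with hA
    set B : ℕ := (N + 1) * p₁ + (N + 1) * m₀ with hB
    have hLB := req hanL (Nat.le_add_right A B)
    have hRA := req hanR (Nat.le_add_left B A)
    have hcongr := laurent_congr (raise hanL (Nat.le_add_right A B)) (raise hanR (Nat.le_add_left B A)) hident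
    beta_reduce at hLB hRA hcongr
    have hfield : (HahnSeries.ofPowerSeries ℤ ℂ 𝓣[fun t : ℂ => exp (Λ t)] : LaurentSeries ℂ) *
        𝓛[N + 1, fun t : ℂ => Φ₂ t / t ^ N] ^ m₁ * 𝓛[N + 1, fun t : ℂ => Φ₃ t / t ^ N] ^ p₀ =
        𝓛[N + 1, fun t : ℂ => Φ₂ t / t ^ N] ^ p₁ * 𝓛[N + 1, fun t : ℂ => Φ₃ t / t ^ N] ^ m₀ := by
      rw [← hpow₀m, ← hpow₁p, ← hpow₀p, ← hpow₁m, ← laurent_of_analyticAt, ← hL1, ← hL, ← hR, ← hLB,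
        ← hRA, hcongr]
    -- non-vanishing of `ŷ₀, ŷ₁`
    have hne : ∀ {Φ : ℂ → ℂ} {μ : ℤ} {ℓ : ℂ → ℂ},
        AnalyticAt ℂ (fun t : ℂ => t ^ (N + 1) * (Φ t / t ^ N)) 0 →
        (∀ᶠ t in 𝓝[≠] (0 : ℂ), Φ t / t ^ N = t ^ μ * exp (ℓ t)) →
        𝓛[N + 1, fun t : ℂ => Φ t / t ^ N] ≠ 0 := by
      intro Φ μ ℓ han hform h0
      rw [laurent_eq_zero_iff han] at h0
      have := (hform.and (h0.and self_mem_nhdsWithin)).exists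
      obtain ⟨t, ht1, ht2, ht3⟩ := this
      have htne : t ≠ 0 := by rintro rfl; exact ht3 (Set.mem_singleton 0)
      rw [ht1] at ht2
      exact mul_ne_zero (zpow_ne_zero _ htne) (Complex.exp_ne_zero _) ht2
    have hŷ₀ := hne hg₀ hy₀
    have hŷ₁ := hne hg₁ hy₁
    have hEalg : IsAlgebraic R'
        (HahnSeries.ofPowerSeries ℤ ℂ 𝓣[fun t : ℂ => exp (Λ t)] : LaurentSeries ℂ) := by
      have hden : 𝓛[N + 1, fun t : ℂ => Φ₂ t / t ^ N] ^ m₁ * 𝓛[N + 1, fun t : ℂ => Φ₃ t / t ^ N] ^ p₀ ≠ 0 :=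
        mul_ne_zero (pow_ne_zero _ hŷ₀) (pow_ne_zero _ hŷ₁)
      have heq : (HahnSeries.ofPowerSeries ℤ ℂ 𝓣[fun t : ℂ => exp (Λ t)] : LaurentSeries ℂ) =
          𝓛[N + 1, fun t : ℂ => Φ₂ t / t ^ N] ^ p₁ * 𝓛[N + 1, fun t : ℂ => Φ₃ t / t ^ N] ^ m₀ *
            (𝓛[N + 1, fun t : ℂ => Φ₂ t / t ^ N] ^ m₁ * 𝓛[N + 1, fun t : ℂ => Φ₃ t / t ^ N] ^ p₀)⁻¹ := by
        rw [eq_mul_inv_iff_mul_eq₀ hden, ← hfield, mul_assoc]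
      rw [heq]
      exact ((ha₂.pow _).mul (ha₃.pow _)).mul ((ha₂.pow _).mul (ha₃.pow _)).inv
    -- ### the contradiction: `Λ, e^Λ` algebraically dependent forces `Λ` constant
    obtain ⟨R, hR0, hRel⟩ := exists_relation_of_isAlgebraic_pair hΛalg hEalg
    have h1 : AnalyticAt ℂ (fun t : ℂ => t ^ 0 * Λ t) 0 := by simpa using hΛan
    have hev := (laurent_eval h1 hEan R (N := 0) (by simp)).1
    beta_reduce at hev
    rw [laurent_of_analyticAt, laurent_of_analyticAt, laurent_of_analyticAt, hRel] at hev
    have hzero : ∀ᶠ t in 𝓝[≠] (0 : ℂ), MvPolynomial.eval ![Λ t, exp (Λ t)] R = 0 := by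
      have han : AnalyticAt ℂ (fun t : ℂ => t ^ 0 * MvPolynomial.eval ![Λ t, exp (Λ t)] R) 0 :=
        (laurent_eval h1 hEan R (N := 0) (by simp)).2
      rw [← laurent_eq_zero_iff han, laurent_of_analyticAt, hev]
    exact hnc (eventually_const_of_relation_exp hΛan hR0 hzero)
  -- ### Step 5: the degenerate section
  obtain ⟨δC, hδC, hC'⟩ := exists_radius_of_eventually_nhds hΛc
  set δ₁ : ℝ := min δA δC with hδ₁
  refine ⟨μ₁, -μ₀, ?_, Λ 0, (hhit δ₁ (lt_min hδA hδC)).mono ?_⟩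
  · rcases hμ with h | h
    · exact Or.inr (neg_ne_zero.2 h)
    · exact Or.inl h
  · rintro x ⟨hxH, t, ht0, htδ, hpt⟩
    refine ⟨hxH, ?_⟩
    obtain ⟨-, -, hL⟩ := hA t ht0 (htδ.trans_le (min_le_left _ _))
    have hx0 : x 0 = (t ^ e)⁻¹ := by
      have := congrFun hpt (Sum.inl 0); simpa using this
    have hx1 : x 1 = Φ₁ t / t ^ N := by
      have := congrFun hpt (Sum.inl 1); simpa using this
    rw [hx0, hx1, Int.cast_neg, neg_mul, ← sub_eq_add_neg, hL]
    exact hC' t (htδ.trans_le (min_le_right _ _))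

end Literature.NumberTheory.Transcendental

end
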